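import Mathlib.Algebra.MvPolynomial.PDeriv
import Mathlib.Algebra.MvPolynomial.Supported
import Mathlib.Algebra.MvPolynomial.CommRing
import Mathlib.Algebra.Ring.GeomSum
import Mathlib.RingTheory.MvPolynomial.Homogeneous
import Mathlib.RingTheory.WittVector.Teichmuller
import Mathlib.RingTheory.WittVector.Domain
import Mathlib.Data.ZMod.Basic
import HarnessLib

/-!
# Linear cycles on the Fermat fourfold: the pair forms `x_u − ζ x_v` and their cofactors

Pure commutative algebra behind stub S4a `stub_linearCycleSupply` of line `gorenstein-ci-seeds`
(crux `PadicSemiregularLift.SemiregularSeedsOnAnchors`): for a pair of variables `{u, v}` and a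
scalar `ζ` with `ζ ^ m = -1`, the linear form `ℓ = x_u − ζ x_v` and the cofactor
`q = Σ_{i<m} x_u^i (ζ x_v)^{m-1-i}` satisfy `ℓ q = x_u^m + x_v^m`; three disjoint pairs give a
factorisation `Σ_t ℓ_t q_t = Σ_i x_i^m` of the Fermat form in six variables (Shioda's linear
cycles `x_u = ζ x_v` on `X⁴_m`; the `dᵢ = 1` case of Movasati–Villaflor).

* `linForm_mul_geomForm`, `sum_linForm_mul_geomForm`: the factorisation (all forms are written
  out: this file introduces no definitions);
* homogeneity, base change along a ring map (`map_linForm`, `map_geomForm`), supports;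
* `pd = ∂_v q + ζ ∂_u q` (the `2 × 2` block determinant of the Jacobian of `(ℓ, q)`) and its
  coefficients `coeff_pairDet : coeff (x_u^a x_v^b) pd = m ζ^{b+1}` for `a + b = m − 2`;
* `coeff_mul_of_mem_supported`: the coefficient of a monomial in a product of polynomials in
  DISJOINT sets of variables is the product of the coefficients;
* arithmetic: `val_pred_add_val_pred` (`(val x − 1) + (val y − 1) = m − 2` when `x + y = 0`,
  `x ≠ 0` in `ℤ/m`), `teichmuller_neg_one` (`[−1] = −1` in `W(k)` for `p ≠ 2`),
  `X_pow_add_X_pow_ne_zero`.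

Everything here is proved; no named facts; no definitions.
-/

set_option linter.dupNamespace false

universe u

namespace Summit.HodgeConjecture.HodgeConjecture.Theorems.SemiregularSeedsOnAnchors.GorensteinCiSeeds

namespace LinearCycle

open MvPolynomial

variable {R : Type*} [CommRing R] {ι : Type*}

/-! ## The pair forms

Conventions of the docstrings: for a pair of variables `u, v` and a scalar `ζ`,
`ℓ = x_u − ζ x_v` is the LINEAR FORM of the pair, `q = Σ_{i<m} x_u^i (ζ x_v)^{m-1-i}` its
COFACTOR in `x_u^m − (ζ x_v)^m`, and `pd = ∂_v q + ζ ∂_u q` the determinant of the Jacobian block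
`[[∂_u ℓ, ∂_v ℓ], [∂_u q, ∂_v q]] = [[1, −ζ], [∂_u q, ∂_v q]]` of `(ℓ, q)`; in the statements these
polynomials are always written out. -/

/-- `(x_u − ζ x_v) · Σ_{i<m} x_u^i (ζ x_v)^{m-1-i} = x_u^m + x_v^m` when `ζ^m = −1`. [folklore] -/
theorem linForm_mul_geomForm (u v : ι) {ζ : R} {m : ℕ} (hζ : ζ ^ m = -1) :
    (X u - C ζ * X v) * (∑ i ∈ Finset.range m, X u ^ i * (C ζ * X v) ^ (m - 1 - i)) =
      X u ^ m + X v ^ m := by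
  rw [mul_comm, geom_sum₂_mul, mul_pow, ← C_pow, hζ, C_neg, C_1]
  ring

/-- `x_u − ζ x_v` is a linear form. [folklore] -/
theorem isHomogeneous_linForm (u v : ι) (ζ : R) :
    (X u - C ζ * X v : MvPolynomial ι R).IsHomogeneous 1 :=
  (isHomogeneous_X R u).sub ((isHomogeneous_X R v).C_mul ζ)

/-- The cofactor is a form of degree `m − 1`. [folklore] -/
theorem isHomogeneous_geomForm (u v : ι) (ζ : R) (m : ℕ) :
    (∑ i ∈ Finset.range m, X u ^ i * (C ζ * X v) ^ (m - 1 - i) : MvPolynomial ι R).IsHomogeneous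
      (m - 1) := by
  refine IsHomogeneous.sum _ _ _ fun i hi => ?_
  rw [Finset.mem_range] at hi
  have h := ((isHomogeneous_X R u).pow i).mul (((isHomogeneous_X R v).C_mul ζ).pow (m - 1 - i))
  rwa [show 1 * i + 1 * (m - 1 - i) = m - 1 by omega] at h

/-- Base change of the linear form along a ring map. [folklore] -/
theorem map_linForm {S : Type*} [CommRing S] (φ : R →+* S) (u v : ι) (ζ : R) :
    MvPolynomial.map φ ((X u - C ζ * X v) : MvPolynomial ι R) = (X u - C (φ ζ) * X v) := by
  simp [map_X, map_C]

/-- Base change of the cofactor along a ring map. [folklore] -/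
theorem map_geomForm {S : Type*} [CommRing S] (φ : R →+* S) (u v : ι) (ζ : R) (m : ℕ) :
    MvPolynomial.map φ (∑ i ∈ Finset.range m, X u ^ i * (C ζ * X v) ^ (m - 1 - i)) =
      ∑ i ∈ Finset.range m, X u ^ i * (C (φ ζ) * X v) ^ (m - 1 - i) := by
  simp [map_X, map_C]

/-- `x_u ∈ k[x_u, x_v]`. [folklore] -/
theorem X_mem_supported_pair_left (u v : ι) :
    (X u : MvPolynomial ι R) ∈ supported R ({u, v} : Set ι) := by
  rw [supported_eq_adjoin_X]
  exact Algebra.subset_adjoin ⟨u, by simp, rfl⟩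

/-- `x_v ∈ k[x_u, x_v]`. [folklore] -/
theorem X_mem_supported_pair_right (u v : ι) :
    (X v : MvPolynomial ι R) ∈ supported R ({u, v} : Set ι) := by
  rw [supported_eq_adjoin_X]
  exact Algebra.subset_adjoin ⟨v, by simp, rfl⟩

/-- Constants lie in every `k[x_S]`. [folklore] -/
theorem C_mem_supported (s : Set ι) (a : R) : (C a : MvPolynomial ι R) ∈ supported R s := by
  rw [← algebraMap_eq]
  exact Subalgebra.algebraMap_mem _ a

/-- The cofactor only involves the variables `x_u, x_v`. [folklore] -/
theorem geomForm_mem_supported (u v : ι) (ζ : R) (m : ℕ) :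
    (∑ i ∈ Finset.range m, X u ^ i * (C ζ * X v) ^ (m - 1 - i) : MvPolynomial ι R) ∈
      supported R ({u, v} : Set ι) :=
  Subalgebra.sum_mem _ fun _ _ =>
    Subalgebra.mul_mem _ (Subalgebra.pow_mem _ (X_mem_supported_pair_left u v) _)
      (Subalgebra.pow_mem _ (Subalgebra.mul_mem _ (C_mem_supported _ ζ)
        (X_mem_supported_pair_right u v)) _)

/-- The linear form only involves the variables `x_u, x_v`. [folklore] -/
theorem linForm_mem_supported (u v : ι) (ζ : R) :
    ((X u - C ζ * X v) : MvPolynomial ι R) ∈ supported R ({u, v} : Set ι) :=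
  Subalgebra.sub_mem _ (X_mem_supported_pair_left u v)
    (Subalgebra.mul_mem _ (C_mem_supported _ ζ) (X_mem_supported_pair_right u v))

/-- `∂_j q = 0` for a variable `x_j` outside the pair. [folklore] -/
theorem pderiv_geomForm_of_ne {j u v : ι} (hu : j ≠ u) (hv : j ≠ v) (ζ : R) (m : ℕ) :
    pderiv j ((∑ i ∈ Finset.range m, X u ^ i * (C ζ * X v) ^ (m - 1 - i)) : MvPolynomial ι R) = 0 :=
  pderiv_eq_zero_of_notMem_vars fun h => by
    have := mem_supported.mp (geomForm_mem_supported (R := R) u v ζ m) h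
    simp only [Set.mem_insert_iff, Set.mem_singleton_iff] at this
    exact this.elim hu hv

/-- `∂_j ℓ`: `1` at `j = u`, `−ζ` at `j = v`, `0` otherwise. [folklore] -/
theorem pderiv_linForm [DecidableEq ι] (j u v : ι) (ζ : R) :
    pderiv j ((X u - C ζ * X v) : MvPolynomial ι R) =
      (if u = j then 1 else 0) - C ζ * (if v = j then 1 else 0) := by
  simp [Pi.single_apply]

/-- The cofactor as a sum of monomials `ζ^{m-1-i} x_u^i x_v^{m-1-i}`. [folklore] -/
theorem geomForm_eq_sum_monomial (u v : ι) (ζ : R) (m : ℕ) :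
    (∑ i ∈ Finset.range m, X u ^ i * (C ζ * X v) ^ (m - 1 - i) : MvPolynomial ι R) =
      ∑ i ∈ Finset.range m,
      monomial (Finsupp.single u i + Finsupp.single v (m - 1 - i)) (ζ ^ (m - 1 - i)) := by
  refine Finset.sum_congr rfl fun i _ => ?_
  rw [mul_pow, ← C_pow, X_pow_eq_monomial, X_pow_eq_monomial, C_mul_monomial, monomial_mul]
  simp

/-- The coefficients of the cofactor. [folklore] -/
theorem coeff_geomForm [DecidableEq ι] (u v : ι) (ζ : R) (m : ℕ) (d : ι →₀ ℕ) :
    coeff d (∑ i ∈ Finset.range m, X u ^ i * (C ζ * X v) ^ (m - 1 - i) : MvPolynomial ι R) =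
      ∑ i ∈ Finset.range m,
      if Finsupp.single u i + Finsupp.single v (m - 1 - i) = d then ζ ^ (m - 1 - i) else 0 := by
  rw [geomForm_eq_sum_monomial, coeff_sum]
  simp only [coeff_monomial]

/-- The coefficient of the cofactor at an exponent `d`: it is `ζ^{m-1-d(u)}` if
`d = (d(u), m-1-d(u))` on `(u, v)` and zero elsewhere, and `0` otherwise. [folklore] -/
theorem coeff_geomForm_eq_ite [DecidableEq ι] {u v : ι} (huv : u ≠ v) (ζ : R) (m : ℕ)
    (d : ι →₀ ℕ) :
    coeff d ((∑ i ∈ Finset.range m, X u ^ i * (C ζ * X v) ^ (m - 1 - i)) : MvPolynomial ι R) =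
      if d u < m ∧ Finsupp.single u (d u) + Finsupp.single v (m - 1 - d u) = d
      then ζ ^ (m - 1 - d u) else 0 := by
  rw [coeff_geomForm]
  have key : ∀ i, Finsupp.single u i + Finsupp.single v (m - 1 - i) = d → i = d u := by
    intro i h
    have := DFunLike.congr_fun h u
    simpa [Finsupp.single_apply, huv.symm] using this
  split_ifs with h
  · rw [Finset.sum_eq_single (d u)]
    · rw [if_pos h.2]
    · intro i _ hne
      exact if_neg fun h' => hne (key i h')
    · intro hn
      exact absurd (Finset.mem_range.mpr h.1) hn
  · refine Finset.sum_eq_zero fun i hi => if_neg fun h' => ?_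
    obtain rfl := key i h'
    exact h ⟨Finset.mem_range.mp hi, h'⟩

/-! ## The `2 × 2` Jacobian block of a pair -/

/-- Partial derivatives do not introduce variables. [folklore] -/
theorem vars_pderiv_subset [DecidableEq ι] (i : ι) (p : MvPolynomial ι R) :
    (pderiv i p).vars ⊆ p.vars := by
  intro w hw
  rw [mem_vars_iff_mem_support] at hw ⊢
  obtain ⟨d, hd, hwd⟩ := hw
  refine ⟨d + Finsupp.single i 1, ?_, ?_⟩
  · rw [MvPolynomial.mem_support_iff] at hd ⊢
    rw [coeff_pderiv] at hd
    exact left_ne_zero_of_mul hd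
  · rw [Finsupp.mem_support_iff] at hwd ⊢
    rw [Finsupp.add_apply]
    omega

/-- Partial derivatives preserve `k[x_S]`. [folklore] -/
theorem pderiv_mem_supported (i : ι) {p : MvPolynomial ι R} {s : Set ι}
    (hp : p ∈ supported R s) : pderiv i p ∈ supported R s := by
  classical
  rw [mem_supported] at hp ⊢
  exact (Finset.coe_subset.mpr (vars_pderiv_subset i p)).trans hp

/-- The Jacobian block determinant `pd = ∂_v q + ζ ∂_u q` only involves `x_u, x_v`. [folklore] -/
theorem pairDet_mem_supported (u v : ι) (ζ : R) (m : ℕ) {g : MvPolynomial ι R}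
    (hg : g = ∑ i ∈ Finset.range m, X u ^ i * (C ζ * X v) ^ (m - 1 - i)) :
    pderiv v g + C ζ * pderiv u g ∈ supported R ({u, v} : Set ι) := by
  subst hg
  exact Subalgebra.add_mem _ (pderiv_mem_supported v (geomForm_mem_supported u v ζ m))
    (Subalgebra.mul_mem _ (C_mem_supported _ ζ)
      (pderiv_mem_supported u (geomForm_mem_supported u v ζ m)))

/-- The coefficients of `pairDet = ∂_v q + ζ ∂_u q = m ζ Σ_{a+b=m-2} ζ^b x_u^a x_v^b`: at an
exponent `d` supported on `{u, v}` with `d(u) + d(v) = m − 2` it is `m ζ^{d(v)+1}`. [folklore] -/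
theorem coeff_pairDet [DecidableEq ι] {u v : ι} (huv : u ≠ v) (ζ : R) {m : ℕ} (hm : 2 ≤ m)
    {g : MvPolynomial ι R} (hg : g = ∑ i ∈ Finset.range m, X u ^ i * (C ζ * X v) ^ (m - 1 - i))
    (d : ι →₀ ℕ) (hd : d u + d v = m - 2) (hd' : ∀ w, w ≠ u → w ≠ v → d w = 0) :
    coeff d (pderiv v g + C ζ * pderiv u g) = (m : R) * ζ ^ (d v + 1) := by
  subst hg
  have h1 : coeff (d + Finsupp.single v 1)
      ((∑ i ∈ Finset.range m, X u ^ i * (C ζ * X v) ^ (m - 1 - i)) : MvPolynomial ι R) =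
        ζ ^ (d v + 1) := by
    rw [coeff_geomForm_eq_ite huv, if_pos]
    · congr 1
      simp [huv]
      omega
    · refine ⟨by simp [huv]; omega, ?_⟩
      ext w
      by_cases hwu : w = u
      · subst hwu; simp [huv]
      · by_cases hwv : w = v
        · subst hwv
          simp [huv]
          omega
        · simp [Finsupp.single_apply, Ne.symm hwu, Ne.symm hwv, hd' w hwu hwv]
  have h2 : coeff (d + Finsupp.single u 1)
      (∑ i ∈ Finset.range m, X u ^ i * (C ζ * X v) ^ (m - 1 - i) : MvPolynomial ι R) =
        ζ ^ (d v) := by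
    rw [coeff_geomForm_eq_ite huv, if_pos]
    · congr 1
      simp
      omega
    · refine ⟨by simp; omega, ?_⟩
      ext w
      by_cases hwu : w = u
      · subst hwu; simp [huv]
      · by_cases hwv : w = v
        · subst hwv
          simp [huv]
          omega
        · simp [Ne.symm hwu, Ne.symm hwv, hd' w hwu hwv]
  have hmR : (m : R) = (d u : R) + (d v : R) + 2 := by
    have : m = d u + d v + 2 := by omega
    rw [this]; push_cast; ring
  rw [coeff_add, coeff_C_mul, coeff_pderiv, coeff_pderiv, h1, h2, hmR]
  ring

/-! ## Coefficients of products of polynomials in disjoint variables -/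

/-- If `P ∈ k[x_S]` and `Q ∈ k[x_{Sᶜ}]`, the coefficient of `x^e` in `P Q` is the product of the
coefficients of `x^{e|S}` in `P` and of `x^{e|Sᶜ}` in `Q`. [folklore] -/
theorem coeff_mul_of_mem_supported [DecidableEq ι] (S : Finset ι) {P Q : MvPolynomial ι R}
    (hP : P ∈ supported R (↑S : Set ι)) (hQ : Q ∈ supported R ((↑S : Set ι)ᶜ)) (e : ι →₀ ℕ) :
    coeff e (P * Q) = coeff (e.filter (· ∈ S)) P * coeff (e.filter (· ∉ S)) Q := by
  rw [mem_supported] at hP hQ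
  have hP' : ∀ a : ι →₀ ℕ, coeff a P ≠ 0 → ∀ w, w ∉ S → a w = 0 := by
    intro a ha w hw
    by_contra haw
    exact hw (Finset.mem_coe.mp (hP ((mem_vars_iff_mem_support w).mpr
      ⟨a, MvPolynomial.mem_support_iff.mpr ha, Finsupp.mem_support_iff.mpr haw⟩)))
  have hQ' : ∀ b : ι →₀ ℕ, coeff b Q ≠ 0 → ∀ w, w ∈ S → b w = 0 := by
    intro b hb w hw
    by_contra hbw
    exact (Set.mem_compl (hQ ((mem_vars_iff_mem_support w).mpr
      ⟨b, MvPolynomial.mem_support_iff.mpr hb, Finsupp.mem_support_iff.mpr hbw⟩)))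
      (Finset.mem_coe.mpr hw)
  rw [coeff_mul]
  apply Finset.sum_eq_single (e.filter (· ∈ S), e.filter (· ∉ S))
  · rintro ⟨a, b⟩ hab hne
    rw [Finset.mem_antidiagonal] at hab
    subst hab
    by_contra h
    have ha : coeff a P ≠ 0 := left_ne_zero_of_mul h
    have hb : coeff b Q ≠ 0 := right_ne_zero_of_mul h
    apply hne
    refine Prod.ext ?_ ?_ <;> ext w <;> simp only [Finsupp.filter_apply, Finsupp.add_apply] <;>
      split_ifs with hw
    · rw [hQ' b hb w hw, add_zero]
    · exact hP' a ha w hw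
    · exact hQ' b hb w hw
    · rw [hP' a ha w hw, zero_add]
  · intro h
    exact absurd (Finset.mem_antidiagonal.mpr (Finsupp.filter_add_filter_not e (· ∈ S))) h

/-! ## Arithmetic -/

/-- In `ℤ/m`: if `x ≠ 0` and `x + y = 0` then `(val x − 1) + (val y − 1) = m − 2` (the exponent
`a − 1` of a pair has total degree `m − 2` on the pair). [folklore] -/
theorem val_pred_add_val_pred {m : ℕ} [NeZero m] {x y : ZMod m} (hx : x ≠ 0) (h : x + y = 0) :
    (x.val - 1) + (y.val - 1) = m - 2 := by
  obtain rfl : y = -x := eq_neg_of_add_eq_zero_right h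
  rw [ZMod.neg_val, if_neg hx]
  have h1 := ZMod.val_lt x
  have h2 : x.val ≠ 0 := fun h0 => hx ((ZMod.val_eq_zero x).mp h0)
  omega

/-- The Teichmüller lift of `−1` is `−1` in `W(k)` for `k` a domain of odd characteristic.
[folklore] -/
theorem teichmuller_neg_one (p : ℕ) [Fact p.Prime] (k : Type*) [CommRing k] [CharP k p]
    [IsDomain k] (hp : p ≠ 2) : WittVector.teichmuller p (-1 : k) = -1 := by
  have hsq : WittVector.teichmuller p (-1 : k) * WittVector.teichmuller p (-1 : k) = 1 := by
    rw [← map_mul, neg_one_mul, neg_neg, map_one]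
  rcases mul_self_eq_one_iff.mp hsq with h | h
  · exfalso
    have h0 := congr_arg WittVector.constantCoeff h
    rw [map_one, WittVector.constantCoeff_apply, WittVector.teichmuller_coeff_zero] at h0
    have h2 : ((2 : ℕ) : k) = 0 := by
      rw [Nat.cast_two]
      linear_combination -h0
    have hdvd : p ∣ 2 := (CharP.cast_eq_zero_iff k p 2).mp h2
    have := Nat.le_of_dvd two_pos hdvd
    have := (Fact.out : p.Prime).two_le
    omega
  · exact h

/-- `x_u^m + x_v^m ≠ 0` for `u ≠ v`, `m ≠ 0`. [folklore] -/
theorem X_pow_add_X_pow_ne_zero [Nontrivial R] {u v : ι} (huv : u ≠ v) {m : ℕ} (hm : m ≠ 0) :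
    (X u ^ m + X v ^ m : MvPolynomial ι R) ≠ 0 := by
  classical
  intro h
  have := congr_arg (coeff (Finsupp.single u m)) h
  rw [coeff_add, coeff_X_pow, coeff_X_pow, if_pos rfl, if_neg, coeff_zero, add_zero] at this
  · exact one_ne_zero this
  · intro h'
    have := DFunLike.congr_fun h' u
    simp [huv.symm, hm.symm] at this

/-! ## Three disjoint pairs in six variables -/

/-- `Σ_t ℓ_t q_t = Σ_i x_i^m` for the three pairs `{σ(2t), σ(2t+1)}`. [folklore] -/
theorem sum_linForm_mul_geomForm (σ : Equiv.Perm (Fin 6)) {ζ : R} {m : ℕ} (hζ : ζ ^ m = -1) :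
    ∑ t : Fin 3, (X (σ (![0, 2, 4] t)) - C ζ * X (σ (![1, 3, 5] t))) *
        (∑ i ∈ Finset.range m,
          X (σ (![0, 2, 4] t)) ^ i * (C ζ * X (σ (![1, 3, 5] t))) ^ (m - 1 - i)) =
      ∑ i : Fin 6, (X i : MvPolynomial (Fin 6) R) ^ m := by
  simp_rw [linForm_mul_geomForm _ _ hζ]
  rw [Fin.sum_univ_three, ← Equiv.sum_comp σ (fun i => (X i : MvPolynomial (Fin 6) R) ^ m),
    Fin.sum_univ_six]
  simp
  ring

/-! ## Registered sub-goal (closed form) -/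

/-- Registered sub-goal of stub `stub_linearCycleSupply` (closed form of
`coeff_mul_of_mem_supported`): the coefficient of `x^e` in a product `P Q` with `P ∈ R[x_S]`,
`Q ∈ R[x_{Sᶜ}]` is `coeff_{e|S} P · coeff_{e|Sᶜ} Q`. [folklore] -/
theorem coeff_mul_of_mem_supported_compl :
    ∀ (R : Type u) [CommRing R] (ι : Type u) [DecidableEq ι] (S : Finset ι)
      (P Q : MvPolynomial ι R) (_ : P ∈ MvPolynomial.supported R (↑S : Set ι))
      (_ : Q ∈ MvPolynomial.supported R ((↑S : Set ι)ᶜ)) (e : ι →₀ ℕ),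
      MvPolynomial.coeff e (P * Q) =
        MvPolynomial.coeff (e.filter (· ∈ S)) P * MvPolynomial.coeff (e.filter (· ∉ S)) Q := by
  intro R _ ι _ S P Q hP hQ e
  exact coeff_mul_of_mem_supported S hP hQ e

end LinearCycle

end Summit.HodgeConjecture.HodgeConjecture.Theorems.SemiregularSeedsOnAnchors.GorensteinCiSeeds
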